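import Summits.QuantumFields.YangMills.Theorems.BalabanUVNodesN15TwoSpacingGluingCurvedKnitSmallFieldPair
import Summits.QuantumFields.YangMills.Theorems.BalabanUVNodesN15BackgroundDressedInverse
import Summits.QuantumFields.YangMills.Theorems.BalabanUVNodesN15AdjointGaugeAction
import Summits.QuantumFields.YangMills.Theorems.BalabanUVNodesN15TwoSpacingGluingCurvedKnitSmallFieldNodeObjects
import HarnessLib

/-!
# N15 = NE2 — Σ-col (I): THE LIVE GLUED COVARIANT PROPAGATOR AT THE TRIVIAL GAUGE FIELD IS THE PIN's `Δ_a⁻¹ ⊗ 1_colour`, AND THE EXACT INCREMENT IDENTITY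
# (dag-n15-a g28, programme Σ-col, FILE (I); node N15 = NE2; `--kind proof --supports stmt-QuantumFields-27366 --as helper`, count-neutral, theorems only)

WHY.  N15 [NE2] is discharged of record AS CONSUMED by K3⁸ v7's U-blind pin (`K3V5Defs.N15PinnedSized`: the operator layer is dag-n15-a's
two-grid family built on Bałaban's `G = Δ_a⁻¹`, part 39 `gOp`), with caveat (C-N15-1) and FLAG №13: the non-abelian `G(U)` dressing of NE2 lives in
dag-n15-c's LIVE small-field family, whose operator entries are built on the glued covariant propagator `cvGlued … u U P N_V` of FILE 127
(`…TwoSpacingGluingCurvedKnitObjects`), a two-sided inverse of `Δ_{U} ⊗ ⋯ + N_L` in the small-field regime (FILE 133 `sf_cvGlued_pair_spec`).  This file is the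
first brick of the bridge between the two readings, kernel-checked:

* §1 DICTIONARY: at the trivial transports the cover's operator `Δ_1 + N_L` (FILE 28 `covLapM τ η 1` plus FILE 127's flat nonlocal part `cvNL = (aQ*Q − ∂Π∂*) ⊗ 1_ι`)
  IS `Δ_a ⊗ 1_ι` (part 46 `deltaOp_eq` = [B4] (1.69), FILE 31 `tensorId_symbOp_sLap`), at both spacings of the cover; `(Δ_a ⊗ 1)(G ⊗ 1) = 1 = (G ⊗ 1)(Δ_a ⊗ 1)`.
* §2 ABSTRACT RESOLVENT ALGEBRA: a left inverse `X` of `T` and a right inverse `G` of `D` differ by `X − G = X(D − T)G`; two-sided ⇒ also `= G(D − T)X`; `XT = 1 = TG ⇒ X = G`.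
* §3 ★★★ `exists_cvGlued_zero_eq_tensorId_gOp`: in FILE 133's regime (`k ≥ 1`, `L^m ≥ w₀`), AT THE ZERO GAUGE FIELD the live glued propagators of the cover at both
  spacings ARE `Δ_a⁻¹ ⊗ 1_ι` — dag-n15-c's `G(U)` at `U ≡ 1` is the v7 pin's `G`, colour by colour (uniqueness of two-sided inverses; no estimate).
* §4 ★★★ `exists_sfEntry0_zero_eq_tensorId_idef`: hence FILE 141's ENTRY-0 operator of the live small-field family at `A′ = 0` is `𝔇(G′, G) ⊗ 1_ι` — the U-blind pin's
  entry 0 tensored with the colour (dag-n15-a N-II `idef_tensorId`): the live and the U-blind editions AGREE at `U ≡ 1`.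
* §5 ★★ `sub_tensorId_gOp_eq_of_comp_eq_id` ∕ `…'` ∕ `…_fine`: for ANY transport datum `R` and any left (right) inverse `X` of `Δ_R + N_L` — in particular FILE 133's
  `cvGlued(A)` — the EXACT increment identity `X − G ⊗ 1 = X ∘ V_R ∘ (G ⊗ 1)` (`= (G ⊗ 1) ∘ V_R ∘ X`) with `V_R = speciesOpM τ η⁻¹ (tCoefC η R) (tCoefA η R)` the exact
  species of FILE 28 `covLapM_eq_one_sub_speciesOpM` ((3.53): `Δ_R = Δ_1 − V_R`) — the algebraic half of the increment LETTER of the sequel `…LiveGluedPropagatorIncrementLetter`.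

Honest label: operator identities only (no estimate, no count).  Nothing in the tree is modified; no landed name is re-declared.
[cite: Balaban1984PropagatorsI, (1.69)–(1.71) pp.29–30; Balaban1985BackgroundPropagators, (3.50)–(3.53) p.400, (3.62)–(3.65) pp.402–403]
-/

open scoped BigOperators Matrix Matrix.Norms.Frobenius

namespace Summit.QuantumFields.YangMills.BalabanUVNodes.N15.GluedZeroField

open Literature.MathematicalPhysics.QuantumFieldTheory.Balaban1983to89
open Literature.MathematicalPhysics.QuantumFieldTheory.Balaban1983to89.B5Prop11Plancherel (Tor fine)
open Literature.Barriers.QuantumFields (traceForm)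
open Summit.QuantumFields.YangMills.BalabanUVNodes.N15.BackgroundLayer (covLapM tCoefA tCoefC gavgM gavgM_zero speciesOpM covLapM_eq_one_sub_speciesOpM coordMat_one
  tensorId_symbOp_sLap tensorId_id tensorId_add tensorId_comp_tensorId)
open Summit.QuantumFields.YangMills.BalabanUVNodes.N15.VectorPiece (bshiftEquiv kingPrV tensorId)
open Summit.QuantumFields.YangMills.BalabanUVNodes.N15.MatrixSpecies (coordMat)
open Summit.QuantumFields.YangMills.BalabanUVNodes.N15.TwoGrid (gOp deltaOp landauRe qvRe qvAdjRe deltaOp_eq deltaOp_comp_gOp gOp_comp_deltaOp)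
open Summit.QuantumFields.YangMills.BalabanUVNodes.N15.CurvedSpecies (gaugePair gaugePair_one mulLeftRight_one_one)
open Summit.QuantumFields.YangMills.BalabanUVNodes.N15.Gluing (cvM CvX CvX' cvNL cvNL' cvGlued cvGlued' sf_cvGlued_pair_spec SfIdx sfEntry0)
open Literature.MathematicalPhysics.QuantumFieldTheory.Balaban1983to89.T4EtaRateDefect (idef)
open Literature.MathematicalPhysics.QuantumFieldTheory.Balaban1983to89.T4EtaRateCoeffDefect (pull)
open Summit.QuantumFields.YangMills.BalabanUVNodes.N15.VectorPiece (idef_tensorId)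
open Summit.QuantumFields.YangMills.BalabanUVNodes.N15.MatrixSpecies (liftMap)

variable {d : ℕ}

/-! ## §1 The cover's operator at the trivial transports is `Δ_a ⊗ 1_ι` -/

section Dictionary

variable {L : ℕ} [NeZero L]

/-- ★ **`Δ_1 + N_L = Δ_a ⊗ 1_ι` AT THE COVER's SPACING `η = L^{−k}`**: FILE 28's covariant Laplacian at the trivial transports plus FILE 127's flat nonlocal part is
Bałaban's `Δ_a = Δ − ∂Π∂* + aQ*Q` (part 46 `deltaOp_eq`) lifted to the colour. [cite: Balaban1984PropagatorsI, (1.69) p.29; Balaban1985BackgroundPropagators, (3.50) p.400 (at U ≡ 1)] -/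
theorem covLapM_one_add_cvNL (mv kk : ℕ) (hL : Odd L ∧ 1 < L) (a : ℝ) (ι : Type) [Fintype ι] [DecidableEq ι] :
    covLapM (bshiftEquiv (cvM d L mv kk hL) (L ^ kk)) ((((L ^ kk : ℕ) : ℝ))⁻¹) (fun (_ : Fin (d + 1) ⊕ Fin (d + 1)) (_ : CvX d L mv kk hL) => (1 : Matrix ι ι ℝ)) +
        cvNL d L mv kk hL a ι = tensorId ι (deltaOp (cvM d L mv kk hL) (L ^ kk) a) := by
  rw [← tensorId_symbOp_sLap ι (cvM d L mv kk hL) (L ^ kk), cvNL, ← tensorId_add, deltaOp_eq]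
  congr 1
  abel

/-- ★ The same AT THE FINE SPACING `η′ = L^{−(r+k)}` (FILE 128's `cvNL'`). [cite: Balaban1984PropagatorsI, (1.69) p.29; Balaban1985BackgroundPropagators, (3.50) p.400 (at U ≡ 1)] -/
theorem covLapM_one_add_cvNL' (mv kk r : ℕ) (hL : Odd L ∧ 1 < L) (a : ℝ) (ι : Type) [Fintype ι] [DecidableEq ι] :
    covLapM (bshiftEquiv (cvM d L mv kk hL) (L ^ r * L ^ kk)) ((((L ^ r * L ^ kk : ℕ) : ℝ))⁻¹) (fun (_ : Fin (d + 1) ⊕ Fin (d + 1)) (_ : CvX' d L mv kk r hL) => (1 : Matrix ι ι ℝ)) +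
        cvNL' d L mv kk r hL a ι = tensorId ι (deltaOp (cvM d L mv kk hL) (L ^ r * L ^ kk) a) := by
  rw [← tensorId_symbOp_sLap ι (cvM d L mv kk hL) (L ^ r * L ^ kk), cvNL', ← tensorId_add, deltaOp_eq]
  congr 1
  abel

variable (ι : Type) (M : Fin (d + 1) → ℕ) [∀ μ, NeZero (M μ)] (n : ℕ) [NeZero n]

omit [NeZero L] in
/-- `(Δ_a ⊗ 1)(G ⊗ 1) = 1` (part 39 `deltaOp_comp_gOp` lifted to the colour). [cite: Balaban1984PropagatorsI, (1.71) p.30] -/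
theorem tensorId_deltaOp_comp_tensorId_gOp (hn : 1 ≤ n) {a : ℝ} (ha : 0 < a) :
    tensorId ι (deltaOp M n a) ∘ₗ tensorId ι (gOp M n a) = LinearMap.id := by
  rw [tensorId_comp_tensorId, deltaOp_comp_gOp M n a hn ha, tensorId_id]

omit [NeZero L] in
/-- `(G ⊗ 1)(Δ_a ⊗ 1) = 1` (part 39 `gOp_comp_deltaOp` lifted to the colour). [cite: Balaban1984PropagatorsI, (1.71) p.30] -/
theorem tensorId_gOp_comp_tensorId_deltaOp (hn : 1 ≤ n) {a : ℝ} (ha : 0 < a) :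
    tensorId ι (gOp M n a) ∘ₗ tensorId ι (deltaOp M n a) = LinearMap.id := by
  rw [tensorId_comp_tensorId, gOp_comp_deltaOp M n a hn ha, tensorId_id]

end Dictionary

/-! ## §2 Abstract resolvent algebra -/

section Resolvent

variable {V : Type} [AddCommGroup V] [Module ℝ V]

/-- **THE RESOLVENT IDENTITY, one-sided**: a left inverse `X` of `T` and a right inverse `G` of `D` satisfy `X − G = X(D − T)G`. [folklore] -/
theorem sub_eq_comp_sub_comp (X T D G : V →ₗ[ℝ] V) (hXT : X ∘ₗ T = LinearMap.id) (hDG : D ∘ₗ G = LinearMap.id) :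
    X - G = X ∘ₗ (D - T) ∘ₗ G := by
  rw [LinearMap.sub_comp, LinearMap.comp_sub, hDG, LinearMap.comp_id, ← LinearMap.comp_assoc, hXT, LinearMap.id_comp]

/-- **THE RESOLVENT IDENTITY, other side**: a right inverse `X` of `T` and a left inverse `G` of `D` satisfy `X − G = G(D − T)X`. [folklore] -/
theorem sub_eq_comp_sub_comp' (X T D G : V →ₗ[ℝ] V) (hTX : T ∘ₗ X = LinearMap.id) (hGD : G ∘ₗ D = LinearMap.id) :
    X - G = G ∘ₗ (D - T) ∘ₗ X := by
  rw [LinearMap.sub_comp, LinearMap.comp_sub, hTX, LinearMap.comp_id, ← LinearMap.comp_assoc, hGD, LinearMap.id_comp]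

/-- **UNIQUENESS OF INVERSES**: `XT = 1` and `TG = 1` give `X = G`. [folklore] -/
theorem eq_of_comp_eq_id_of_comp_eq_id (X T G : V →ₗ[ℝ] V) (hXT : X ∘ₗ T = LinearMap.id) (hTG : T ∘ₗ G = LinearMap.id) : X = G := by
  calc X = X ∘ₗ (T ∘ₗ G) := by rw [hTG, LinearMap.comp_id]
    _ = G := by rw [← LinearMap.comp_assoc, hXT, LinearMap.id_comp]

end Resolvent

/-! ## §3 At the zero gauge field the live glued propagators are `Δ_a⁻¹ ⊗ 1_ι` -/

section ZeroField

variable {L : ℕ} [NeZero L]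

/-- The transport datum of the trivial bond field in coordinates is the trivial datum: `coordMat e (Ad_{1}) = 1`. [folklore] -/
theorem coordMat_mulLeftRight_one_conjTranspose {ι mm : Type} [Fintype ι] [DecidableEq ι] [Fintype mm] [DecidableEq mm] (e : Matrix mm mm ℂ ≃L[ℝ] (ι → ℝ)) :
    coordMat e (ContinuousLinearMap.mulLeftRight ℝ (Matrix mm mm ℂ) (1 : Matrix mm mm ℂ) (1 : Matrix mm mm ℂ)ᴴ) = 1 := by
  rw [Matrix.conjTranspose_one, mulLeftRight_one_one, coordMat_one]

/-- ★★★ **AT THE ZERO GAUGE FIELD THE LIVE GLUED COVARIANT PROPAGATORS OF THE COVER ARE `Δ_a⁻¹ ⊗ 1_ι`.**  In FILE 133's regime (`L ≥ 7` odd, `a > 0`,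
`k ≥ 1`, `L^m ≥ w₀(d, L, a, ι)`), for every trace-form-orthonormal coordinate system `e` of `M_N(ℂ) ≅ ℝ^ι`: dag-n15-c's glued propagators (FILE 127 `cvGlued` at
spacing `L^{−k}`, FILE 128 `cvGlued'` at spacing `L^{−(r+k)}`) of the trivial per-cube gauges, the TRIVIAL bond field, no Bałaban summand and no nonlocal
perturbation are `G ⊗ 1_ι` with `G = Δ_a⁻¹` of part 39 on the cover's torus — the U-blind pin's operator, colour by colour.  (Uniqueness of two-sided
inverses: FILE 133's `X(Δ_1 + N_L) = 1`, §1's `Δ_1 + N_L = Δ_a ⊗ 1`, part 39's `Δ_aG = 1`.)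
[cite: Balaban1984PropagatorsI, (1.69)–(1.71) pp.29–30; Balaban1985BackgroundPropagators, (3.50) p.400, (3.62)–(3.65) pp.402–403] -/
theorem exists_cvGlued_zero_eq_tensorId_gOp (hL : Odd L ∧ 1 < L) (hL7 : 7 ≤ L) {a : ℝ} (ha : 0 < a) (ι : Type) [Fintype ι] [DecidableEq ι] :
    ∃ w₀ : ℝ, ∀ (mv kk r : ℕ), 1 ≤ kk → w₀ ≤ ((L ^ mv : ℕ) : ℝ) →
      ∀ {mm : Type} [Fintype mm] [DecidableEq mm] (e : Matrix mm mm ℂ ≃L[ℝ] (ι → ℝ)), (∀ A B : Matrix mm mm ℂ, traceForm A B = e A ⬝ᵥ e B) →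
        cvGlued d L mv kk hL a ((((L ^ kk : ℕ) : ℝ))⁻¹) ι e (fun _ _ => (1 : Matrix mm mm ℂ)) (fun _ _ => (1 : Matrix mm mm ℂ)) (cvNL d L mv kk hL a ι) (fun _ => 0) =
            tensorId ι (gOp (cvM d L mv kk hL) (L ^ kk) a) ∧
        cvGlued' d L mv kk r hL a ((((L ^ r * L ^ kk : ℕ) : ℝ))⁻¹) ι e (fun _ _ => (1 : Matrix mm mm ℂ)) (fun _ _ => (1 : Matrix mm mm ℂ)) (cvNL' d L mv kk r hL a ι) (fun _ => 0) =
            tensorId ι (gOp (cvM d L mv kk hL) (L ^ r * L ^ kk) a) := by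
  obtain ⟨δ, w₀, R₀, B, hδ, hR₀, hB, H⟩ := sf_cvGlued_pair_spec (d := d) hL hL7 ha ι
  refine ⟨w₀, fun mv kk r hk hw mm _ _ e he => ?_⟩
  have hLpos : 0 < L := lt_trans Nat.zero_lt_one hL.2
  have hn : 1 ≤ L ^ kk := Nat.one_le_pow kk L hLpos
  have hn' : 1 ≤ L ^ r * L ^ kk := Nat.one_le_iff_ne_zero.mpr (Nat.mul_ne_zero (pow_ne_zero r hLpos.ne') (pow_ne_zero kk hLpos.ne'))
  obtain ⟨⟨-, hXT, -⟩, ⟨-, hXT', -⟩⟩ := H mv kk r hk hw e he 0 (fun _ _ => by simp) 0 le_rfl (fun _ _ => by simp) (fun _ _ _ => by simp) (fun _ _ _ => by simp)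
    (by simp only [mul_zero]; norm_num) (by simp only [mul_zero, zero_mul]; exact hR₀.le)
  simp only [gavgM_zero, Pi.zero_apply, smul_zero, NormedSpace.exp_zero, coordMat_mulLeftRight_one_conjTranspose, gaugePair_one] at hXT hXT'
  rw [covLapM_one_add_cvNL] at hXT
  rw [covLapM_one_add_cvNL'] at hXT'
  exact ⟨eq_of_comp_eq_id_of_comp_eq_id _ _ _ hXT (tensorId_deltaOp_comp_tensorId_gOp ι _ _ hn ha),
    eq_of_comp_eq_id_of_comp_eq_id _ _ _ hXT' (tensorId_deltaOp_comp_tensorId_gOp ι _ _ hn' ha)⟩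

end ZeroField

/-! ## §4 Consequence for dag-n15-c's small-field family: ENTRY 0 at the zero field is the pin's two-grid defect `⊗ 1_ι` -/

section EntryZero

variable {L : ℕ} [NeZero L]

/-- ★★★ **ENTRY 0 OF THE LIVE SMALL-FIELD FAMILY AT THE ZERO FIELD IS THE U-BLIND PIN's ENTRY 0, COLOUR BY COLOUR.**  For every index `i` of dag-n15-c's small-field
family with `L^{m_i} ≥ w₀(d, L, a, ι)` and every trace-form-orthonormal `e`: FILE 141's entry-0 operator `sfEntry0 i A′ = 𝔇(X′(A′), X(A′))` (the two-grid η-defect of the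
live glued pair through King's pairing ⊗ 1_ι) AT `A′ = 0` equals `𝔇(G′, G) ⊗ 1_ι` — the two-grid defect of Bałaban's `Δ_a⁻¹` at the two spacings (the object of the v7 pin's
operator row, part 39 `gOp`), tensored with the colour (§3 + dag-n15-a N-II `idef_tensorId`).  The consistency face of FLAG №13: the live `G(U)` edition and the U-blind
edition AGREE at `U ≡ 1`. [cite: Balaban1985BackgroundPropagators, Thm 3.1 (3.42) p.397 (entry 0: shape), (3.62)–(3.65) pp.402–403; Balaban1984PropagatorsI, (1.71) p.30] -/
theorem exists_sfEntry0_zero_eq_tensorId_idef (hL : Odd L ∧ 1 < L) (hL7 : 7 ≤ L) {a : ℝ} (ha : 0 < a) (ι mm : Type) [Fintype ι] [DecidableEq ι] [Fintype mm] [DecidableEq mm] :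
    ∃ w₀ : ℝ, ∀ (i : SfIdx d L), w₀ ≤ ((L ^ i.m : ℕ) : ℝ) → ∀ (e : Matrix mm mm ℂ ≃L[ℝ] (ι → ℝ)), (∀ A B : Matrix mm mm ℂ, traceForm A B = e A ⬝ᵥ e B) →
      sfEntry0 d mm ι a e hL i 0 =
        tensorId ι (idef (pull (kingPrV L i.kk i.r (cvM d L i.m i.kk hL))) (pull (kingPrV L i.kk i.r (cvM d L i.m i.kk hL)))
          (gOp (cvM d L i.m i.kk hL) (L ^ i.r * L ^ i.kk) a) (gOp (cvM d L i.m i.kk hL) (L ^ i.kk) a)) := by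
  obtain ⟨w₀, H⟩ := exists_cvGlued_zero_eq_tensorId_gOp (d := d) hL hL7 ha ι
  refine ⟨w₀, fun i hw e he => ?_⟩
  obtain ⟨h₁, h₂⟩ := H i.m i.kk i.r i.one_le hw e he
  rw [sfEntry0]
  simp only [gavgM_zero, Pi.zero_apply, smul_zero, NormedSpace.exp_zero]
  rw [h₁, h₂, idef_tensorId]

end EntryZero

/-! ## §5 The exact increment identity for any transport datum -/

section Increment

variable {L : ℕ} [NeZero L]

/-- ★★ **THE EXACT INCREMENT IDENTITY** (cover's spacing): for any transport datum `R` on the cover and any LEFT inverse `X` of `Δ_R + N_L` — FILE 133's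
`cvGlued(A)` is one in its regime — `X − G ⊗ 1_ι = X ∘ V_R ∘ (G ⊗ 1_ι)` with the EXACT species `V_R = speciesOpM τ L^k (tCoefC η R) (tCoefA η R)` of (3.53)
(FILE 28 `covLapM_eq_one_sub_speciesOpM`). [cite: Balaban1985BackgroundPropagators, (3.50)–(3.53) p.400; Balaban1984PropagatorsI, (1.71) p.30] -/
theorem sub_tensorId_gOp_eq_of_comp_eq_id (mv kk : ℕ) (hL : Odd L ∧ 1 < L) {a : ℝ} (ha : 0 < a) (ι : Type) [Fintype ι] [DecidableEq ι]
    (R : Fin (d + 1) ⊕ Fin (d + 1) → CvX d L mv kk hL → Matrix ι ι ℝ) (X : (CvX d L mv kk hL × ι → ℝ) →ₗ[ℝ] (CvX d L mv kk hL × ι → ℝ))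
    (hX : X ∘ₗ (covLapM (bshiftEquiv (cvM d L mv kk hL) (L ^ kk)) ((((L ^ kk : ℕ) : ℝ))⁻¹) R + cvNL d L mv kk hL a ι) = LinearMap.id) :
    X - tensorId ι (gOp (cvM d L mv kk hL) (L ^ kk) a) =
      X ∘ₗ speciesOpM (bshiftEquiv (cvM d L mv kk hL) (L ^ kk)) ((L ^ kk : ℕ) : ℝ) (tCoefC ((((L ^ kk : ℕ) : ℝ))⁻¹) R) (tCoefA ((((L ^ kk : ℕ) : ℝ))⁻¹) R) ∘ₗ
        tensorId ι (gOp (cvM d L mv kk hL) (L ^ kk) a) := by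
  have hLpos : 0 < L := lt_trans Nat.zero_lt_one hL.2
  have hn : 1 ≤ L ^ kk := Nat.one_le_pow kk L hLpos
  have h := sub_eq_comp_sub_comp X _ _ _ hX (tensorId_deltaOp_comp_tensorId_gOp ι (cvM d L mv kk hL) (L ^ kk) hn ha)
  rw [← covLapM_one_add_cvNL mv kk hL a ι, add_sub_add_right_eq_sub, covLapM_eq_one_sub_speciesOpM (bshiftEquiv (cvM d L mv kk hL) (L ^ kk)) ((((L ^ kk : ℕ) : ℝ))⁻¹) R,
    sub_sub_cancel, inv_inv] at h
  exact h

/-- ★★ **THE EXACT INCREMENT IDENTITY, two-sided form**: for a RIGHT inverse `X` of `Δ_R + N_L`, `X − G ⊗ 1_ι = (G ⊗ 1_ι) ∘ V_R ∘ X`.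
[cite: Balaban1985BackgroundPropagators, (3.50)–(3.53) p.400; Balaban1984PropagatorsI, (1.71) p.30] -/
theorem sub_tensorId_gOp_eq_of_comp_eq_id' (mv kk : ℕ) (hL : Odd L ∧ 1 < L) {a : ℝ} (ha : 0 < a) (ι : Type) [Fintype ι] [DecidableEq ι]
    (R : Fin (d + 1) ⊕ Fin (d + 1) → CvX d L mv kk hL → Matrix ι ι ℝ) (X : (CvX d L mv kk hL × ι → ℝ) →ₗ[ℝ] (CvX d L mv kk hL × ι → ℝ))
    (hX : (covLapM (bshiftEquiv (cvM d L mv kk hL) (L ^ kk)) ((((L ^ kk : ℕ) : ℝ))⁻¹) R + cvNL d L mv kk hL a ι) ∘ₗ X = LinearMap.id) :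
    X - tensorId ι (gOp (cvM d L mv kk hL) (L ^ kk) a) =
      tensorId ι (gOp (cvM d L mv kk hL) (L ^ kk) a) ∘ₗ
        speciesOpM (bshiftEquiv (cvM d L mv kk hL) (L ^ kk)) ((L ^ kk : ℕ) : ℝ) (tCoefC ((((L ^ kk : ℕ) : ℝ))⁻¹) R) (tCoefA ((((L ^ kk : ℕ) : ℝ))⁻¹) R) ∘ₗ X := by
  have hLpos : 0 < L := lt_trans Nat.zero_lt_one hL.2
  have hn : 1 ≤ L ^ kk := Nat.one_le_pow kk L hLpos
  have h := sub_eq_comp_sub_comp' X _ _ _ hX (tensorId_gOp_comp_tensorId_deltaOp ι (cvM d L mv kk hL) (L ^ kk) hn ha)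
  rw [← covLapM_one_add_cvNL mv kk hL a ι, add_sub_add_right_eq_sub, covLapM_eq_one_sub_speciesOpM (bshiftEquiv (cvM d L mv kk hL) (L ^ kk)) ((((L ^ kk : ℕ) : ℝ))⁻¹) R,
    sub_sub_cancel, inv_inv] at h
  exact h

/-- ★★ The increment identity AT THE FINE SPACING (FILE 128's `cvGlued'` regime), left-inverse form. [cite: Balaban1985BackgroundPropagators, (3.50)–(3.53) p.400] -/
theorem sub_tensorId_gOp_eq_of_comp_eq_id_fine (mv kk r : ℕ) (hL : Odd L ∧ 1 < L) {a : ℝ} (ha : 0 < a) (ι : Type) [Fintype ι] [DecidableEq ι]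
    (R : Fin (d + 1) ⊕ Fin (d + 1) → CvX' d L mv kk r hL → Matrix ι ι ℝ) (X : (CvX' d L mv kk r hL × ι → ℝ) →ₗ[ℝ] (CvX' d L mv kk r hL × ι → ℝ))
    (hX : X ∘ₗ (covLapM (bshiftEquiv (cvM d L mv kk hL) (L ^ r * L ^ kk)) ((((L ^ r * L ^ kk : ℕ) : ℝ))⁻¹) R + cvNL' d L mv kk r hL a ι) = LinearMap.id) :
    X - tensorId ι (gOp (cvM d L mv kk hL) (L ^ r * L ^ kk) a) =
      X ∘ₗ speciesOpM (bshiftEquiv (cvM d L mv kk hL) (L ^ r * L ^ kk)) ((L ^ r * L ^ kk : ℕ) : ℝ) (tCoefC ((((L ^ r * L ^ kk : ℕ) : ℝ))⁻¹) R)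
        (tCoefA ((((L ^ r * L ^ kk : ℕ) : ℝ))⁻¹) R) ∘ₗ tensorId ι (gOp (cvM d L mv kk hL) (L ^ r * L ^ kk) a) := by
  have hLpos : 0 < L := lt_trans Nat.zero_lt_one hL.2
  have hn' : 1 ≤ L ^ r * L ^ kk := Nat.one_le_iff_ne_zero.mpr (Nat.mul_ne_zero (pow_ne_zero r hLpos.ne') (pow_ne_zero kk hLpos.ne'))
  have h := sub_eq_comp_sub_comp X _ _ _ hX (tensorId_deltaOp_comp_tensorId_gOp ι (cvM d L mv kk hL) (L ^ r * L ^ kk) hn' ha)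
  rw [← covLapM_one_add_cvNL' mv kk r hL a ι, add_sub_add_right_eq_sub,
    covLapM_eq_one_sub_speciesOpM (bshiftEquiv (cvM d L mv kk hL) (L ^ r * L ^ kk)) ((((L ^ r * L ^ kk : ℕ) : ℝ))⁻¹) R, sub_sub_cancel, inv_inv] at h
  exact h

end Increment

end Summit.QuantumFields.YangMills.BalabanUVNodes.N15.GluedZeroField
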